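import Literature.AlgebraicGeometry.Frobenioids.ModelFrobenioidPreFrobenioid
import HarnessLib

/-!
# Frobenioids I, Theorem 5.2 (ii), first sentence — part 1b: pull-back morphisms of the model
# Frobenioid; `C` is connected and totally epimorphic (abc-iut cell, layer L1, node F-D1a)

Mochizuki, *The geometry of Frobenioids I: the general theory*, Kyushu J. Math. **62** (2008)
293–400, §5, Theorem 5.2 (i)–(ii), kurims text pp. 100–101 [cite: MochizukiFrdI2008, Thm. 5.2(ii) p.101].

Continuation of `ModelFrobenioidPreFrobenioid.lean`: the pull-back morphisms of
`C = ModelFrobenioid Φ B DivB` are exactly the linear morphisms with `Div = 0` (test object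
`(A_D, Base(φ)^* β)`; `Φ` divisorial, `B` group-like), `C` is totally epimorphic (`D` totally
epimorphic, `Φ(f)`, `B(f)` injective, cancellation) and connected (`D` connected; `(A_D, α)` and
`(A_D, 0)` receive arrows from a common `(A_D, γ)`), whence `C → F_Φ` is a pre-Frobenioid
(Def. 1.1 (iv)). No statement of the paper is strengthened.
-/

noncomputable section

namespace Literature.AlgebraicGeometry.Frobenioids

namespace ModelFrobenioid

open CategoryTheory Opposite

universe w v u

variable {D : Type u} [Category.{v} D] {Φ B : Dᵒᵖ ⥤ CommMonCat.{w}} {DivB : B ⟶ monoidGp Φ}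

/-! ### Pull-back morphisms of `C` are the linear morphisms with vanishing zero divisor -/

section Pullback

variable {X Y : ModelFrobenioid Φ B DivB}

/-- A pull-back morphism of `C` is linear with `Div = 0` (test object `(A_D, Base(φ)^* β)`).
[cite: MochizukiFrdI2008, Thm. 5.2(ii) p.101] -/
theorem degFr_div_of_isPullbackMorphism (hΦd : Objectwise (fun M _ => IsDivisorial M) Φ) {φ : X ⟶ Y}
    (h : PreFrobenioid.IsPullbackMorphism (toElem Φ B DivB) φ) : degFr φ = 1 ∧ div φ = 1 := by
  let f : X.base ⟶ Y.base := baseMap φ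
  let W : ModelFrobenioid Φ B DivB := ⟨X.base, pullGp Φ f Y.cls⟩
  let δ : W ⟶ Y := mkHom W Y 1 f 1 1 (by
    show pullGp Φ f Y.cls ^ ((1 : ℕ+) : ℕ) * Algebra.GrothendieckGroup.of 1 =
      pullGp Φ f Y.cls * divB Φ B DivB (op X.base) 1
    rw [PNat.one_coe, pow_one, map_one, mul_one, map_one, mul_one])
  obtain ⟨γ, hγ⟩ := (h W).2 ⟨(δ, 𝟙 X.base), show f = 𝟙 X.base ≫ f from (Category.id_comp _).symm⟩
  have e1 : γ ≫ φ = δ :=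
    congrArg (fun p : PreFrobenioid.PullbackHomData (toElem Φ B DivB) φ W => p.1.1) hγ
  have e2 : baseMap γ = 𝟙 X.base :=
    congrArg (fun p : PreFrobenioid.PullbackHomData (toElem Φ B DivB) φ W => p.1.2) hγ
  have hn : degFr φ * degFr γ = 1 := congrArg Hom.degFr e1
  have hd : pull Φ (baseMap γ) (div φ) * div γ ^ (degFr φ : ℕ) = 1 := congrArg Hom.div e1
  have hφ : degFr φ = 1 := pnat_eq_one_of_mul_eq_one hn
  rw [e2, pull_id, hφ, PNat.one_coe, pow_one] at hd
  exact ⟨hφ, (hΦd X.base).isSharp.eq_one_of_isUnit _ (IsUnit.of_mul_eq_one _ hd)⟩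

/-- A linear morphism of `C` with `Div = 0` is a pull-back morphism (`Φ` integral, `B` group-like).
[cite: MochizukiFrdI2008, Thm. 5.2(ii) p.101] -/
theorem isPullbackMorphism_of (hΦd : Objectwise (fun M _ => IsDivisorial M) Φ)
    (hBg : Objectwise (fun M _ => IsGroupLike M) B) {φ : X ⟶ Y} (hn : degFr φ = 1) (hd : div φ = 1) :
    PreFrobenioid.IsPullbackMorphism (toElem Φ B DivB) φ := by
  obtain ⟨uu, huu⟩ := (hBg X.base).isUnit (unit φ)
  have hφ : X.cls = pullGp Φ (baseMap φ) Y.cls * divB Φ B DivB _ (unit φ) := by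
    have h := rel φ
    rwa [hn, hd, PNat.one_coe, pow_one, map_one, mul_one] at h
  intro W
  haveI : IsCancelMul (Φ.obj (op W.base)) :=
    isIntegral_iff_isCancelMul.mp (hΦd W.base).isPreDivisorial.isIntegral
  haveI : IsCancelMul (B.obj (op W.base)) :=
    isIntegral_iff_isCancelMul.mp (hBg W.base).isPreDivisorial.isIntegral
  constructor
  · intro γ γ' e
    have e1 : γ ≫ φ = γ' ≫ φ :=
      congrArg (fun p : PreFrobenioid.PullbackHomData (toElem Φ B DivB) φ W => p.1.1) e
    have e2 : baseMap γ = baseMap γ' :=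
      congrArg (fun p : PreFrobenioid.PullbackHomData (toElem Φ B DivB) φ W => p.1.2) e
    have hdeg : degFr φ * degFr γ = degFr φ * degFr γ' := congrArg Hom.degFr e1
    have hdiv : pull Φ (baseMap γ) (div φ) * div γ ^ (degFr φ : ℕ) =
        pull Φ (baseMap γ') (div φ) * div γ' ^ (degFr φ : ℕ) := congrArg Hom.div e1
    have hun : pull B (baseMap γ) (unit φ) * unit γ ^ (degFr φ : ℕ) =
        pull B (baseMap γ') (unit φ) * unit γ' ^ (degFr φ : ℕ) := congrArg Hom.unit e1
    rw [e2, hn, PNat.one_coe, pow_one, pow_one] at hdiv hun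
    rw [hn, one_mul, one_mul] at hdeg
    exact hom_ext hdeg e2 (mul_left_cancel hdiv) (mul_left_cancel hun)
  · rintro ⟨⟨δ, ε⟩, hδ⟩
    let ε₀ : W.base ⟶ X.base := ε
    have hδ' : baseMap δ = ε₀ ≫ baseMap φ := hδ
    refine ⟨mkHom W X (degFr δ) ε₀ (div δ) (↑(Units.map (pull B ε₀) uu)⁻¹ * unit δ) ?_,
      Subtype.ext (Prod.ext (hom_ext ?_ hδ'.symm ?_ ?_) rfl)⟩
    · rw [rel δ, hδ', pullGp_comp, hφ, map_mul (pullGp Φ ε₀), pullGp_divB_pull, mul_assoc,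
        ← map_mul (divB Φ B DivB _), ← mul_assoc (pull B ε₀ (unit φ)), ← huu, ← Units.coe_map,
        Units.mul_inv, one_mul]
    · show degFr φ * degFr δ = degFr δ
      rw [hn, one_mul]
    · show pull Φ ε₀ (div φ) * div δ ^ (degFr φ : ℕ) = div δ
      rw [hd, map_one, one_mul, hn, PNat.one_coe, pow_one]
    · show pull B ε₀ (unit φ) * (↑(Units.map (pull B ε₀) uu)⁻¹ * unit δ) ^ (degFr φ : ℕ) = unit δ
      rw [hn, PNat.one_coe, pow_one, ← mul_assoc, ← huu, ← Units.coe_map, Units.mul_inv, one_mul]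

/-- Pull-back morphisms of `C` are exactly the linear morphisms with `Div = 0`.
[cite: MochizukiFrdI2008, Thm. 5.2(ii) p.101] -/
theorem isPullbackMorphism_iff (hΦd : Objectwise (fun M _ => IsDivisorial M) Φ)
    (hBg : Objectwise (fun M _ => IsGroupLike M) B) (φ : X ⟶ Y) :
    PreFrobenioid.IsPullbackMorphism (toElem Φ B DivB) φ ↔ degFr φ = 1 ∧ div φ = 1 :=
  ⟨degFr_div_of_isPullbackMorphism hΦd, fun h => isPullbackMorphism_of hΦd hBg h.1 h.2⟩

end Pullback

/-! ### `C` is connected and totally epimorphic: the pre-Frobenioid `C → F_Φ` -/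

/-- `C` is totally epimorphic (`D` totally epimorphic; `Φ`, `B` monoids on `D` with cancellative
values). [cite: MochizukiFrdI2008, Thm. 5.2(ii) p.101] -/
theorem isTotallyEpimorphic (hΦ : IsMonoidOn Φ) (hΦd : Objectwise (fun M _ => IsDivisorial M) Φ)
    (hB : IsMonoidOn B) (hBg : Objectwise (fun M _ => IsGroupLike M) B) (hDe : IsTotallyEpimorphic D) :
    IsTotallyEpimorphic (ModelFrobenioid Φ B DivB) := by
  refine ⟨fun {X Y} φ => ⟨fun {Z} ψ ψ' e => ?_⟩⟩
  haveI : IsCancelMul (Φ.obj (op X.base)) :=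
    isIntegral_iff_isCancelMul.mp (hΦd X.base).isPreDivisorial.isIntegral
  haveI : IsCancelMul (B.obj (op X.base)) :=
    isIntegral_iff_isCancelMul.mp (hBg X.base).isPreDivisorial.isIntegral
  haveI := hDe.epi (baseMap φ)
  have hdeg : degFr ψ * degFr φ = degFr ψ' * degFr φ := congrArg Hom.degFr e
  have hb : baseMap φ ≫ baseMap ψ = baseMap φ ≫ baseMap ψ' := congrArg Hom.base e
  have hdiv : pull Φ (baseMap φ) (div ψ) * div φ ^ (degFr ψ : ℕ) =
      pull Φ (baseMap φ) (div ψ') * div φ ^ (degFr ψ' : ℕ) := congrArg Hom.div e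
  have hun : pull B (baseMap φ) (unit ψ) * unit φ ^ (degFr ψ : ℕ) =
      pull B (baseMap φ) (unit ψ') * unit φ ^ (degFr ψ' : ℕ) := congrArg Hom.unit e
  have hdeg' : degFr ψ = degFr ψ' := mul_right_cancel hdeg
  rw [hdeg'] at hdiv hun
  exact hom_ext hdeg' ((cancel_epi (baseMap φ)).mp hb)
    ((hΦ.isCharInjective (baseMap φ)).1 (mul_right_cancel hdiv))
    ((hB.isCharInjective (baseMap φ)).1 (mul_right_cancel hun))

/-- `C` is connected (`D` connected): `(A_D, α)` and `(A_D, 0)` receive arrows from a common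
`(A_D, γ)`, and the zero section maps zigzags of `D` to zigzags of `C`.
[cite: MochizukiFrdI2008, Thm. 5.2(ii) p.101] -/
theorem isGraphConnected (hDc : IsGraphConnected D) : IsGraphConnected (ModelFrobenioid Φ B DivB) := by
  obtain ⟨⟨A₀⟩, hz⟩ := hDc
  -- every object is joined to the zero section over its base
  have link : ∀ X : ModelFrobenioid Φ B DivB, Zigzag X ((zeroSection Φ B DivB).obj X.base) := by
    intro X
    obtain ⟨a, b, hab⟩ := gp_exists_mul_of_eq_of X.cls
    let W : ModelFrobenioid Φ B DivB := ⟨X.base, (Algebra.GrothendieckGroup.of b)⁻¹⟩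
    have w₁ : W ⟶ X := mkHom W X 1 (𝟙 _) a 1 (by
      show (Algebra.GrothendieckGroup.of b)⁻¹ ^ ((1 : ℕ+) : ℕ) * Algebra.GrothendieckGroup.of a =
        pullGp Φ (𝟙 X.base) X.cls * divB Φ B DivB _ 1
      rw [PNat.one_coe, pow_one, pullGp_id, map_one, mul_one, inv_mul_eq_iff_eq_mul, ← hab, mul_comm])
    have w₂ : W ⟶ (zeroSection Φ B DivB).obj X.base := mkHom W _ 1 (𝟙 _) b 1 (by
      show (Algebra.GrothendieckGroup.of b)⁻¹ ^ ((1 : ℕ+) : ℕ) * Algebra.GrothendieckGroup.of b =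
        pullGp Φ (𝟙 X.base) 1 * divB Φ B DivB _ 1
      rw [PNat.one_coe, pow_one, inv_mul_cancel, pullGp_id, map_one, mul_one])
    exact (Zigzag.of_inv w₁).trans (Zigzag.of_hom w₂)
  refine ⟨⟨(zeroSection Φ B DivB).obj A₀⟩, fun X Y => ?_⟩
  exact (link X).trans ((zigzag_obj_of_zigzag (zeroSection Φ B DivB) (hz X.base Y.base)).trans
    (link Y).symm)

/-- **Thm. 5.2 (ii), standing part**: `C → F_Φ` is a pre-Frobenioid (Def. 1.1 (iv)) for `Φ`
divisorial, `B` group-like monoids on a connected, totally epimorphic `D`.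
[cite: MochizukiFrdI2008, Thm. 5.2(ii) p.101] -/
theorem isPreFrobenioid (hΦ : IsMonoidOn Φ) (hΦd : Objectwise (fun M _ => IsDivisorial M) Φ)
    (hB : IsMonoidOn B) (hBg : Objectwise (fun M _ => IsGroupLike M) B) (hDc : IsGraphConnected D)
    (hDe : IsTotallyEpimorphic D) : IsPreFrobenioid Φ (toElem Φ B DivB) where
  isMonoidOn := hΦ
  isDivisorial := hΦd
  isGraphConnected_base := hDc
  isTotallyEpimorphic_base := hDe
  isGraphConnected := isGraphConnected hDc
  isTotallyEpimorphic := isTotallyEpimorphic hΦ hΦd hB hBg hDe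

end ModelFrobenioid

end Literature.AlgebraicGeometry.Frobenioids
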